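import Literature.NumberTheory.LFunctions.Zhang2022.Section8XiDipoleTaylor
import Literature.NumberTheory.LFunctions.Zhang2022.KnifeEdgeLenZDegreeK0Short
import HarnessLib

/-!
# Zhang (2022) §8: the anti-side row of `S_j` for PROFILE data — the `n`-sum `Σ_n conj(𝐚_u(tn))ξ₀ⱼ(n;d,r)/n` of Prop 7.1's
# `S_j` at a `C²` short piece is the twisted-superposition sum of `W_t(z) = ū(z_t + z)`, hence, given Lemma 8.4 pointwise
# (hypothesis `hE`) and the low-range majorant (hypothesis `hB`), `= χ(t)Λ⁻¹L′Π(d,r)·[−ū′(z_t) + (C+γ+γA)ū(z_t) +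
# γ²A∫_{z_t}^{θ}ū] + O(…)` — LEMMA A*'s MASS RULE at the shift `z_t` (Zhang's display after Lemma 8.4, `Step8u042`, general `u`)

Topic `Literature/NumberTheory/LFunctions/Zhang2022` (Landau–Siegel audit tree; verdict-neutral). Y. Zhang, *Discrete mean
estimates and the Landau–Siegel zero*, arXiv:2211.02515v1 (2022) [Zhang2022LandauSiegel] — **an unrefereed manuscript
under adjudication; nothing here asserts or denies its Theorems 1–2; no claim about Landau–Siegel zeros.** Cell
landau-siegel §D, crux K0 = stmt-Parity-20459 (row (S) `KnifeEdge.SjProfileRow`, p537807), prover ls-knife-K0-p1 g0.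
Companion of `Section8DipoleProfile` (ψ-side). The two analytic inputs are DISPLAYED as hypotheses at the fixed modulus
(the caller takes `hE` from the tree theorem `Skeleton.Lemma84Rel` via `frakg_eq_gProfile`, and `hB` from
`XiZeroTailMean.xiZeroTailMean`); everything else is bookkeeping: the `n`-sum identity (`sjInner_anti_eq`, for a REAL
character: `conj χ = χ`), the twisted Taylor data of `W_t = ū(z_t + ·)` (`twTaylor`), the transfer
(`xiDipole_superposed`) and the mass-rule identity (`massRule_identity`).

## References
* Y. Zhang, arXiv:2211.02515v1 (2022), §8 Lemmas 8.3–8.4 and the display after Lemma 8.4, p. 17; §7 Prop 7.1 (`S_j`).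
  [cite: Zhang2022LandauSiegel, §8 Lemma 8.4]
-/

noncomputable section

open Complex Real Finset MeasureTheory intervalIntegral Set
open scoped ComplexConjugate

namespace Literature.NumberTheory.LFunctions.Zhang2022.DipoleRule

open Skeleton KnifeEdge

/-! ### The `n`-sum of `S_j` at the profile table is the twisted-superposition sum of `ū(z_t + ·)` -/


/-- A real (quadratic) character is fixed by complex conjugation. [folklore] -/
private theorem conj_chi_of_isQuadratic {D : ℕ} {χ : DirichletCharacter ℂ D} (hq : χ.IsQuadratic) (a : ZMod D) :
    conj (χ a) = χ a := by
  rcases hq a with h | h | h <;> simp [h]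

/-- `e^{(θ − log t/Λ)Λ} = e^{θΛ}/t` (`t ≥ 1`, `Λ ≠ 0`). [folklore] -/
private theorem exp_shift_eq' {θ Λ : ℝ} (hΛ : Λ ≠ 0) {t : ℕ} (ht : 1 ≤ t) :
    Real.exp ((θ - Real.log t / Λ) * Λ) = Real.exp (θ * Λ) / t := by
  have ht0 : (0 : ℝ) < t := by exact_mod_cast ht
  rw [sub_mul, div_mul_cancel₀ _ hΛ, Real.exp_sub, Real.exp_log ht0]

/-- **The `n`-sum of Prop 7.1's `S_j` at the (conjugated) profile table of a short piece, outer index `t = dr`, for a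
REAL character `χ`:** `Σ_{1≤n<⌈PT⁻²⌉} conj(𝐚_u(tn))·ξ₀ⱼ(n;d,r)/n = χ(t)·Σ_{1≤n<⌈P^θ/t⌉} χ(n)ξ₀ⱼ(n;d,r)n⁻¹·ū(z_t + z_n)` —
for `u = 0` on `[θ,∞)` and `P^θ < ⌈PT⁻²⌉`. [cite: Zhang2022LandauSiegel, §7 Prop 7.1; §8 display after Lemma 8.4] -/
theorem sjInner_anti_eq {D : ℕ} (χ : DirichletCharacter ℂ D) (hq : χ.IsQuadratic) (c' : ℝ) (j d r : ℕ)
    {u : ℝ → ℂ} {θ : ℝ} (hvan : ∀ y : ℝ, θ ≤ y → u y = 0) (hℓ : 0 < Real.log D) {t : ℕ} (ht : 1 ≤ t)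
    (hθN : Real.exp (θ * Real.log D ^ 9) < Nsupp D) :
    ∑ n ∈ Finset.Ico 1 (Nsupp D), conj (profTable u D χ (t * n)) * xiZero c' D j n d r / (n : ℂ)
      = χ (t : ZMod D) * ∑ n ∈ Finset.Ico 1 ⌈Real.exp ((θ - Real.log t / Real.log D ^ 9) * Real.log D ^ 9)⌉₊,
          χ (n : ZMod D) * xiZero c' D j n d r / (n : ℂ) *
            conj (u (Real.log t / Real.log D ^ 9 + Real.log n / Real.log D ^ 9)) := by
  set Λ : ℝ := Real.log D ^ 9 with hΛ
  have hΛ0 : 0 < Λ := by positivity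
  have ht0 : (0 : ℝ) < t := by exact_mod_cast ht
  have hlogP : Real.log (bigP D) = Λ := by rw [bigP, Real.log_exp]; rfl
  rw [exp_shift_eq' hΛ0.ne' ht]
  set x : ℝ := Real.exp (θ * Λ) / t with hx
  have hx0 : 0 < x := by positivity
  set N : ℕ := ⌈x⌉₊ with hN
  -- `N ≤ Nsupp`
  have hNle : N ≤ Nsupp D := by
    have h1 : x ≤ Real.exp (θ * Λ) := div_le_self (Real.exp_pos _).le (by exact_mod_cast ht)
    exact Nat.ceil_le.mpr (h1.trans hθN.le)
  have h1N : 1 ≤ N := Nat.one_le_iff_ne_zero.mpr (Nat.pos_iff_ne_zero.mp (Nat.ceil_pos.mpr hx0))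
  rw [← Finset.sum_Ico_consecutive _ h1N hNle]
  have htail : ∑ n ∈ Finset.Ico N (Nsupp D), conj (profTable u D χ (t * n)) * xiZero c' D j n d r / (n : ℂ) = 0 := by
    refine Finset.sum_eq_zero fun n hn => ?_
    rw [Finset.mem_Ico] at hn
    have hnx : x ≤ n := (Nat.le_ceil x).trans (by exact_mod_cast hn.1)
    have hn0 : (0 : ℝ) < n := lt_of_lt_of_le hx0 hnx
    have htn : Real.exp (θ * Λ) ≤ (t : ℝ) * n := by rwa [hx, div_le_iff₀' ht0] at hnx
    have hz : θ ≤ Real.log ((t * n : ℕ) : ℝ) / Real.log (bigP D) := by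
      rw [hlogP, le_div_iff₀ hΛ0, ← Real.log_exp (θ * Λ)]
      push_cast
      exact Real.log_le_log (Real.exp_pos _) htn
    unfold profTable
    split_ifs with hg
    · rw [hvan _ hz]; simp
    · simp
  rw [htail, add_zero, Finset.mul_sum]
  refine Finset.sum_congr rfl fun n hn => ?_
  rw [Finset.mem_Ico] at hn
  have hn1 : 1 ≤ n := hn.1
  have hn0 : (0 : ℝ) < n := by exact_mod_cast hn1
  have hnx : (n : ℝ) < x := by
    have h := Nat.ceil_lt_add_one hx0.le
    have : (n : ℝ) + 1 ≤ N := by exact_mod_cast hn.2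
    linarith
  have htn : t * n < Nsupp D := by
    have h2 : (t : ℝ) * n < Real.exp (θ * Λ) := by rwa [hx, lt_div_iff₀' ht0] at hnx
    exact_mod_cast lt_trans h2 hθN
  unfold profTable
  rw [if_pos htn]
  have hlog : Real.log ((t * n : ℕ) : ℝ) / Real.log (bigP D) = Real.log t / Λ + Real.log n / Λ := by
    push_cast
    rw [Real.log_mul ht0.ne' hn0.ne', hlogP, add_div]
  rw [hlog, map_mul, Nat.cast_mul, map_mul, map_mul, conj_chi_of_isQuadratic hq, conj_chi_of_isQuadratic hq]
  ring

/-! ### The anti-side row for a `C²` short piece -/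

/-- Translation carries a right derivative at `z₀ + z` to one at `z`. [folklore] -/
private theorem hasDerivWithinAt_shift' {f : ℝ → ℂ} {f' : ℂ} {z₀ z : ℝ}
    (h : HasDerivWithinAt f f' (Ioi (z₀ + z)) (z₀ + z)) :
    HasDerivWithinAt (fun y : ℝ => f (z₀ + y)) f' (Ioi z) z := by
  have hid : HasDerivWithinAt (fun y : ℝ => z₀ + y) 1 (Ioi z) z := (hasDerivAt_id z).const_add z₀ |>.hasDerivWithinAt
  have hmaps : MapsTo (fun y : ℝ => z₀ + y) (Ioi z) (Ioi (z₀ + z)) := fun y hy => by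
    simp only [Set.mem_Ioi] at hy ⊢; linarith
  have := h.scomp_of_eq z hid hmaps rfl
  rw [one_smul] at this
  exact this

/-- **THE ANTI-SIDE ROW OF `S_j` FOR A `C²` SHORT PIECE (fixed modulus).** Data: a REAL character `χ` mod `D` with
`𝓛 = log D > 0`, `Λ = 𝓛⁹`, `0 < τ`; a profile `u` with `u, u′, u″` continuous on `[0,θ]`, right derivatives inside,
`u = 0` on `[θ,∞)`, bounds `‖u‖ ≤ B₀, ‖u′‖ ≤ B₁, ‖u″‖ ≤ B₂` on `[0,θ]`; an outer index `t ≥ 1` with `τ ≤ Z := θ − z_t`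
(`z_t = log t/Λ`) and `e^{θΛ} < ⌈PT⁻²⌉`; the twist `γ ∈ ℂ` and main-term profile `gProfile A C γ` with constant `M ∈ ℂ`;
and the two DISPLAYED analytic inputs for the twisted Riesz mean `R^ξ` of `χ(n)ξ₀ⱼ(n;d,r)/n` (twist `β_μ` with
`β_μΛ = γ`): `hE` on `[τ, Z]` (Lemma 8.4, `Skeleton.Lemma84Rel`, via `frakg_eq_gProfile`) and `hB` on `[0, τ]`
(`XiZeroTailMean.xiZeroTailMean`). Then, with `ρ`-size `S = B₂ + 2‖γ‖B₁ + ‖γ‖²B₀`: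
`‖Σ_{1≤n<⌈PT⁻²⌉} conj(𝐚_u(tn))ξ₀ⱼ(n;d,r)/n − χ(t)Λ⁻¹M·(−ū′(z_t) + (C+γ+γA)ū(z_t) + γ²A∫₀^Z ū(z_t+y)dy)‖
≤ Λ⁻¹·[E·((B₁) + S·Z) + τ·S·B]`. [cite: Zhang2022LandauSiegel, §8 Lemmas 8.3–8.4 and display after Lemma 8.4] -/
theorem antiRow_C2 {D : ℕ} (χ : DirichletCharacter ℂ D) (hq : χ.IsQuadratic) (c' : ℝ) (j μ d r : ℕ)
    (hℓ : 0 < Real.log D) {u u' u'' : ℝ → ℂ} {θ τ : ℝ} (hτ : 0 < τ)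
    (hu : ContinuousOn u (Icc 0 θ)) (hu' : ContinuousOn u' (Icc 0 θ)) (hu'' : ContinuousOn u'' (Icc 0 θ))
    (hd : ∀ y ∈ Ioo 0 θ, HasDerivWithinAt u (u' y) (Ioi y) y)
    (hd' : ∀ y ∈ Ioo 0 θ, HasDerivWithinAt u' (u'' y) (Ioi y) y) (hvan : ∀ y : ℝ, θ ≤ y → u y = 0)
    {B₀ B₁ B₂ : ℝ} (hB0 : ∀ y ∈ Icc 0 θ, ‖u y‖ ≤ B₀) (hB1 : ∀ y ∈ Icc 0 θ, ‖u' y‖ ≤ B₁)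
    (hB2 : ∀ y ∈ Icc 0 θ, ‖u'' y‖ ≤ B₂) {t : ℕ} (ht : 1 ≤ t)
    (htT : τ ≤ θ - Real.log t / Real.log D ^ 9) (hθN : Real.exp (θ * Real.log D ^ 9) < Nsupp D)
    {γ M : ℂ} {A C : ℂ} {E B : ℝ} (hγ : betaMu D μ * Real.log D ^ 9 = γ)
    (hE : ∀ y ∈ Icc τ (θ - Real.log t / Real.log D ^ 9),
      ‖xiRieszMean c' χ j μ d r (Real.exp (y * Real.log D ^ 9)) - M * gProfile A C γ y‖ ≤ E)
    (hB : ∀ y ∈ Icc (0 : ℝ) τ,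
      ‖xiRieszMean c' χ j μ d r (Real.exp (y * Real.log D ^ 9)) - M * gProfile A C γ y‖ ≤ B) :
    ‖(∑ n ∈ Finset.Ico 1 (Nsupp D), conj (profTable u D χ (t * n)) * xiZero c' D j n d r / (n : ℂ))
        - χ (t : ZMod D) * ((Real.log D ^ 9 : ℝ) : ℂ)⁻¹ * M *
          (-conj (u' (Real.log t / Real.log D ^ 9)) + (C + γ + γ * A) * conj (u (Real.log t / Real.log D ^ 9))
            + γ ^ 2 * A * ∫ y in (0:ℝ)..(θ - Real.log t / Real.log D ^ 9), conj (u (Real.log t / Real.log D ^ 9 + y)))‖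
      ≤ (Real.log D ^ 9)⁻¹ *
        (E * (B₁ + (B₂ + 2 * ‖γ‖ * B₁ + ‖γ‖ ^ 2 * B₀) * (θ - Real.log t / Real.log D ^ 9))
          + τ * (B₂ + 2 * ‖γ‖ * B₁ + ‖γ‖ ^ 2 * B₀) * B) := by
  set Λ : ℝ := Real.log D ^ 9 with hΛ
  set z₀ : ℝ := Real.log t / Λ with hz₀
  set Z : ℝ := θ - z₀ with hZ
  set S : ℝ := B₂ + 2 * ‖γ‖ * B₁ + ‖γ‖ ^ 2 * B₀ with hS
  have hΛ0 : 0 < Λ := by positivity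
  have hZτ : τ ≤ Z := htT
  have hZ0 : 0 < Z := lt_of_lt_of_le hτ hZτ
  have hz₀0 : 0 ≤ z₀ := div_nonneg (Real.log_nonneg (by exact_mod_cast ht)) hΛ0.le
  have hmaps : ∀ z ∈ Icc 0 Z, z₀ + z ∈ Icc 0 θ := fun z hz => ⟨by linarith [hz.1], by linarith [hz.2, hZ]⟩
  -- the conjugated shifted piece and its derivatives
  set W : ℝ → ℂ := fun z => conj (u (z₀ + z)) with hW
  set W' : ℝ → ℂ := fun z => conj (u' (z₀ + z)) with hW'
  set W'' : ℝ → ℂ := fun z => conj (u'' (z₀ + z)) with hW''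
  have hshift : Continuous fun z : ℝ => z₀ + z := continuous_const.add continuous_id
  have hWc : ContinuousOn W (Icc 0 Z) :=
    (Complex.continuous_conj.comp_continuousOn (hu.comp hshift.continuousOn hmaps))
  have hW'c : ContinuousOn W' (Icc 0 Z) :=
    (Complex.continuous_conj.comp_continuousOn (hu'.comp hshift.continuousOn hmaps))
  have hW''c : ContinuousOn W'' (Icc 0 Z) :=
    (Complex.continuous_conj.comp_continuousOn (hu''.comp hshift.continuousOn hmaps))
  have hWd : ∀ z ∈ Ioo 0 Z, HasDerivWithinAt W (W' z) (Ioi z) z := by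
    intro z hz
    have hy : z₀ + z ∈ Ioo 0 θ := ⟨by linarith [hz.1], by linarith [hz.2, hZ]⟩
    have h := (hasDerivWithinAt_shift' (hd (z₀ + z) hy)).star
    simpa [hW, hW'] using h
  have hW'd : ∀ z ∈ Ioo 0 Z, HasDerivWithinAt W' (W'' z) (Ioi z) z := by
    intro z hz
    have hy : z₀ + z ∈ Ioo 0 θ := ⟨by linarith [hz.1], by linarith [hz.2, hZ]⟩
    have h := (hasDerivWithinAt_shift' (hd' (z₀ + z) hy)).star
    simpa [hW', hW''] using h
  have hW''i : IntervalIntegrable W'' volume 0 Z :=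
    ContinuousOn.intervalIntegrable (by rw [Set.uIcc_of_le hZ0.le]; exact hW''c)
  have hWZ : W Z = 0 := by
    simp [hW, hZ, hvan θ le_rfl]
  -- Taylor data: `W = twSuperposedWeight γ ![−W′(Z)] ![Z] Z ρ` on `[0,Z]`
  set ρ : ℝ → ℂ := fun y => W'' y - 2 * γ * W' y + γ ^ 2 * W y with hρ
  have hρi : IntervalIntegrable ρ volume 0 Z := by
    refine (hW''i.sub ?_).add ?_
    · exact ContinuousOn.intervalIntegrable (by rw [Set.uIcc_of_le hZ0.le]; exact continuousOn_const.mul hW'c)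
    · exact ContinuousOn.intervalIntegrable (by rw [Set.uIcc_of_le hZ0.le]; exact continuousOn_const.mul hWc)
  have hρS : ∀ y ∈ Icc (0 : ℝ) τ, ‖ρ y‖ ≤ S := by
    intro y hy
    have hy' : z₀ + y ∈ Icc 0 θ := hmaps y ⟨hy.1, hy.2.trans hZτ⟩
    have e0 : ‖W y‖ ≤ B₀ := by simp only [hW, Complex.norm_conj]; exact hB0 _ hy'
    have e1 : ‖W' y‖ ≤ B₁ := by simp only [hW', Complex.norm_conj]; exact hB1 _ hy'
    have e2 : ‖W'' y‖ ≤ B₂ := by simp only [hW'', Complex.norm_conj]; exact hB2 _ hy'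
    calc ‖ρ y‖ = ‖W'' y - 2 * γ * W' y + γ ^ 2 * W y‖ := rfl
      _ ≤ ‖W'' y - 2 * γ * W' y‖ + ‖γ ^ 2 * W y‖ := norm_add_le _ _
      _ ≤ ‖W'' y‖ + ‖2 * γ * W' y‖ + ‖γ ^ 2 * W y‖ := by gcongr; exact norm_sub_le _ _
      _ ≤ B₂ + 2 * ‖γ‖ * B₁ + ‖γ‖ ^ 2 * B₀ := by
          rw [norm_mul, norm_mul, Complex.norm_two, norm_mul, norm_pow]
          gcongr
  -- the `n`-sum is the superposition sum
  have hsum := sjInner_anti_eq χ hq c' j d r hvan hℓ ht hθN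
  have hindex : Real.exp ((θ - Real.log t / Real.log D ^ 9) * Real.log D ^ 9) = Real.exp (Z * Λ) := by
    rw [hZ, hz₀, hΛ]
  have hterm : ∑ n ∈ Finset.Ico 1 ⌈Real.exp (Z * Λ)⌉₊, χ (n : ZMod D) * xiZero c' D j n d r / (n : ℂ) *
        conj (u (Real.log t / Real.log D ^ 9 + Real.log n / Real.log D ^ 9))
      = ∑ n ∈ Finset.Ico 1 ⌈Real.exp (Z * Λ)⌉₊, χ (n : ZMod D) * xiZero c' D j n d r / (n : ℂ) *
        twSuperposedWeight (betaMu D μ * Λ) ![-W' Z] ![Z] Z ρ (Real.log n / Λ) := by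
    refine Finset.sum_congr rfl fun n hn => ?_
    rw [Finset.mem_Ico] at hn
    have hn0 : (0 : ℝ) < n := by exact_mod_cast hn.1
    have hnx : (n : ℝ) < Real.exp (Z * Λ) := by
      have h := Nat.ceil_lt_add_one (Real.exp_pos (Z * Λ)).le
      have : (n : ℝ) + 1 ≤ ⌈Real.exp (Z * Λ)⌉₊ := by exact_mod_cast hn.2
      linarith
    have hz : Real.log n / Λ ∈ Icc 0 Z := by
      refine ⟨div_nonneg (Real.log_nonneg (by exact_mod_cast hn.1)) hΛ0.le, ?_⟩
      rw [div_le_iff₀ hΛ0, ← Real.log_exp (Z * Λ)]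
      exact Real.log_le_log hn0 hnx.le
    have hγ' : betaMu D μ * (Λ : ℂ) = γ := by rw [← hγ, hΛ]; push_cast; ring
    rw [hγ', ← twTaylor γ hWc hW'c hWd hW'd hW''i hWZ hz]
  rw [hsum, hindex, hterm]
  -- transfer
  have hG : ContinuousOn (gProfile A C γ) (Icc 0 Z) := by
    have : ∀ y, HasDerivAt (gProfile A C γ) (gProfile' A C γ y) y := hasDerivAt_gProfile A C γ
    exact (continuous_iff_continuousAt.mpr fun y => (this y).continuousAt).continuousOn
  have hE' : ∀ y ∈ Icc τ Z, ‖xiRieszMean c' χ j μ d r (Real.exp (y * Λ)) - M * gProfile A C γ y‖ ≤ E := hE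
  have hB' : ∀ y ∈ Icc (0 : ℝ) τ, ‖xiRieszMean c' χ j μ d r (Real.exp (y * Λ)) - M * gProfile A C γ y‖ ≤ B := hB
  have key := xiDipole_superposed (c' := c') (χ := χ) hΛ0 hτ hZτ j μ d r ![-W' Z] ![Z]
    (fun i => by fin_cases i; exact ⟨hZτ, le_rfl⟩) hρi hρS hG hE' hB'
  -- the main term is the mass rule
  have hmass := massRule_identity A C γ hZ0.le hWc hW'c hWd hW'd hW''i hWZ
  have hmain : (∑ i : Fin 1, (![-W' Z] : Fin 1 → ℂ) i * gProfile A C γ ((![Z] : Fin 1 → ℝ) i))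
      + ∫ y in (0:ℝ)..Z, gProfile A C γ y * ρ y
      = -W' 0 + (C + γ + γ * A) * W 0 + γ ^ 2 * A * ∫ y in (0:ℝ)..Z, W y := by
    rw [Fin.sum_univ_one, Matrix.cons_val_zero, Matrix.cons_val_zero, ← hmass]
  rw [hmain] at key
  have hW0 : W 0 = conj (u (Real.log t / Real.log D ^ 9)) := by simp [hW, hz₀, hΛ]
  have hW'0 : W' 0 = conj (u' (Real.log t / Real.log D ^ 9)) := by simp [hW', hz₀, hΛ]
  have hWint : (∫ y in (0:ℝ)..Z, W y) = ∫ y in (0:ℝ)..(θ - Real.log t / Real.log D ^ 9),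
      conj (u (Real.log t / Real.log D ^ 9 + y)) := by rw [hW, hZ, hz₀, hΛ]
  rw [hW0, hW'0, hWint] at key
  have hΛc : ((Real.log D ^ 9 : ℝ) : ℂ) = (Λ : ℂ) := by rw [hΛ]
  rw [hΛc, Finset.mul_sum]
  have hre : ∑ n ∈ Finset.Ico 1 ⌈Real.exp (Z * Λ)⌉₊, χ (t : ZMod D) *
        (χ (n : ZMod D) * xiZero c' D j n d r / (n : ℂ) * twSuperposedWeight (betaMu D μ * Λ) ![-W' Z] ![Z] Z ρ (Real.log n / Λ))
      = χ (t : ZMod D) * ∑ n ∈ Finset.Ico 1 ⌈Real.exp (Z * Λ)⌉₊,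
        χ (n : ZMod D) * xiZero c' D j n d r / (n : ℂ) * twSuperposedWeight (betaMu D μ * Λ) ![-W' Z] ![Z] Z ρ (Real.log n / Λ) := by
    rw [Finset.mul_sum]
  rw [hre, show χ (t : ZMod D) * (Λ : ℂ)⁻¹ * M = χ (t : ZMod D) * ((Λ : ℂ)⁻¹ * M) by ring, mul_assoc (χ (t : ZMod D)),
    ← mul_sub, norm_mul]
  have hχ1 : ‖χ (t : ZMod D)‖ ≤ 1 := χ.norm_le_one _
  -- bound the data norms
  have hWZ' : ‖W' Z‖ ≤ B₁ := by simp only [hW', Complex.norm_conj]; exact hB1 _ (hmaps Z ⟨hZ0.le, le_rfl⟩)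
  have hρint : (∫ y in (0:ℝ)..Z, ‖ρ y‖) ≤ S * Z := by
    have hρall : ∀ y ∈ Icc 0 Z, ‖ρ y‖ ≤ S := by
      intro y hy
      have hy' : z₀ + y ∈ Icc 0 θ := hmaps y hy
      have e0 : ‖W y‖ ≤ B₀ := by simp only [hW, Complex.norm_conj]; exact hB0 _ hy'
      have e1 : ‖W' y‖ ≤ B₁ := by simp only [hW', Complex.norm_conj]; exact hB1 _ hy'
      have e2 : ‖W'' y‖ ≤ B₂ := by simp only [hW'', Complex.norm_conj]; exact hB2 _ hy'
      calc ‖ρ y‖ = ‖W'' y - 2 * γ * W' y + γ ^ 2 * W y‖ := rfl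
        _ ≤ ‖W'' y - 2 * γ * W' y‖ + ‖γ ^ 2 * W y‖ := norm_add_le _ _
        _ ≤ ‖W'' y‖ + ‖2 * γ * W' y‖ + ‖γ ^ 2 * W y‖ := by gcongr; exact norm_sub_le _ _
        _ ≤ B₂ + 2 * ‖γ‖ * B₁ + ‖γ‖ ^ 2 * B₀ := by
            rw [norm_mul, norm_mul, Complex.norm_two, norm_mul, norm_pow]
            gcongr
    have hρc : ContinuousOn ρ (Icc 0 Z) := (hW''c.sub (continuousOn_const.mul hW'c)).add (continuousOn_const.mul hWc)
    have h1 : (∫ y in (0:ℝ)..Z, ‖ρ y‖) ≤ ∫ y in (0:ℝ)..Z, S := by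
      refine intervalIntegral.integral_mono_on hZ0.le ?_ intervalIntegrable_const fun y hy => hρall y hy
      exact ContinuousOn.intervalIntegrable (by rw [Set.uIcc_of_le hZ0.le]; exact hρc.norm)
    rw [intervalIntegral.integral_const, smul_eq_mul, sub_zero] at h1
    linarith [h1]
  have hE0 : 0 ≤ E := (norm_nonneg _).trans (hE τ ⟨le_rfl, hZτ⟩)
  have hfinal : Λ⁻¹ * (E * (∑ i : Fin 1, ‖(![-W' Z] : Fin 1 → ℂ) i‖ + ∫ y in (0:ℝ)..Z, ‖ρ y‖) + τ * S * B)
      ≤ Λ⁻¹ * (E * (B₁ + S * Z) + τ * S * B) := by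
    refine mul_le_mul_of_nonneg_left ?_ (inv_nonneg.mpr hΛ0.le)
    refine add_le_add (mul_le_mul_of_nonneg_left ?_ hE0) le_rfl
    rw [Fin.sum_univ_one, Matrix.cons_val_zero, norm_neg]
    exact add_le_add hWZ' hρint
  calc ‖χ (t : ZMod D)‖ * _ ≤ 1 * _ := mul_le_mul_of_nonneg_right hχ1 (norm_nonneg _)
    _ ≤ _ := by rw [one_mul]; exact key.trans hfinal

end Literature.NumberTheory.LFunctions.Zhang2022.DipoleRule

end
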